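import Mathlib
import HarnessLib
import HarnessLib.Audit
import Literature.InformationTheory.QuantumCodes.BivariateBicycleCodes
import Summits.Ventures.QEC.Census.BB.Claims

/-!
Route: BB90DistanceCertificate

CLOSED (proved) 2026-08-27T01:14:40Z by operator:999:3137891 — reason: proved:Summit.Ventures.QEC.Census.BB90.BB90_8_10_claim_holds. The file is kept as the record of this route; refuted decls are indexed as negative knowledge (`ledger negatives`).

# Route BB90DistanceCertificate — the [[90,8,10]] bivariate-bicycle code has distance exactly 10, by
certificate

It suffices to show X = (no Z-type logical operator of the bivariate-bicycle code QC(x⁹+y+y²,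
1+x²+x⁷) on ℤ₁₅ × ℤ₃ = `BB.bb90` has
Hamming weight ≤ 9) ∧ (some Z-type logical operator has weight exactly 10) ∧ (k = n − rk H^X − rk
H^Z = 8). X is the content of a
DISTANCE CERTIFICATE for the printed row [[90,8,10]] of Bravyi–Cross–Gambetta–Maslov–Rall–Yoder
(Nature 627 (2024) Table 1; distance
there "computed by the mixed integer programming approach", no certificate in print): lower bound =
an exhaustive enumeration / UNSAT
certificate re-checked in the kernel, upper bound = one explicit codeword, dimension = a rank
certificate. The route is the LADDER-QEC
rung-Q2 route of cell pub/qec (venture ruling D-0059/D-0061/D-0092): its deciding theorem concludes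
the registered CLAIM leaf
`Summit.Ventures.QEC.BB.BB90_8_10_claim` (`HasParams BB.bb90 90 8 10`), never a summit Statement
(Ventures/QEC has none). No idea card.
Lean: `(∀ v : Literature.InformationTheory.QuantumCodes.BB.Mono 15 3 ⊕
Literature.InformationTheory.QuantumCodes.BB.Mono 15 3 → ZMod 2, Matrix.mulVec
(Literature.InformationTheory.QuantumCodes.BB.bb90).css.HX v = 0 → v ∉
(Literature.InformationTheory.QuantumCodes.BB.bb90).css.rowSpZ → 10 ≤ hammingNorm v) ∧ (∃ v :
Literature.InformationTheory.QuantumCodes.BB.Mono 15 3 ⊕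
Literature.InformationTheory.QuantumCodes.BB.Mono 15 3 → ZMod 2, Matrix.mulVec
(Literature.InformationTheory.QuantumCodes.BB.bb90).css.HX v = 0 ∧ v ∉
(Literature.InformationTheory.QuantumCodes.BB.bb90).css.rowSpZ ∧ hammingNorm v = 10) ∧
(Literature.InformationTheory.QuantumCodes.BB.bb90).k = 8`

## Assembly
Pure logic over three tree lemmas: from `WeightTenZLogical` take v; `CSSCode.dZ_eq_of_witness hv hv'
hwt NoZLogicalBelowTen : BB.bb90.css.dZ = 10`;
`Summit.Ventures.QEC.BB.numQubits_claims.2.1 : BB.numQubits 15 3 = 90` (counting, proved);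
`EightLogicalQubits90 : BB.bb90.k = 8`; then
`Summit.Ventures.QEC.BB.hasParams_of_dZ` (d = d^Z, Lemma 1, proved) gives `HasParams BB.bb90 90 8 10
= BB90_8_10_claim`. The deciding theorem
`closes` in glue.lean is exactly this, routed through `Assembly` and `Target` so both are in its
cone (lean check rc 0, 0 sorries).

CLOSES_TARGET: closes rung Q2 of Ventures/QEC: Summit.Ventures.QEC.BB.BB90_8_10_claim (D-0061; not the summit Statement) — the deciding theorem of this route concludes that registered leaf (Ventures/QEC: no summit Statement) (class rung: servable and labelled, never counted as concluding the summit Statement).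

Rationale: WHY THIS LINE. The mechanism is the certificate shape of `CSSCode.dZ_eq_of_witness` (tree,
CSS.lean): an explicit logical of weight d plus the universally
checked statement "every logical has weight ≥ d" give d^Z = d, and for every QC(A, B) d = d^Z = d^X
(Lemma 1 of [BravyiEtAl2024],
arXiv:2308.07915 §4, proved in the tree as `BB.Code.d_eq_dZ`), so one side suffices (cell CERT-REQS
C8). The lower bound is the only
expensive conjunct: it is discharged by certificates the cell already holds and a referee has
ROW-SIGNED (certA = search-1 Brouwer–Zimmermann-with-automorphisms enumeration (bz)
sha16 a5d2f23cbb488a6a; certB = search-2 CNF→CaDiCaL→LRAT sha16 1ac6a0cc1f6d3ffd, lemma-free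
encoding enc-v1; ref-1
ROW-SIGNED 2026-08-26T18:40:03Z, assumes=none), replayed in Lean by type-10's checker
`Summits/Ventures/QEC/Census/CertCheck.lean`
(`checkDistCert` + soundness, p461106) on the flat matrices `BB.bb90.HXFlat/HZFlat` and transported
to `BB.bb90.css` by the landed bridge
`BB.Code.dZ_eq_of_flat` / `cssFlat_dZ` / `cssFlat_k`. Imported from coding theory:
Brouwer–Zimmermann / information-set enumeration
(search-7's information-set variant) and DRAT/LRAT proof logging for the UNSAT side. What the line
does that print does not: Nature ED Table 1 reports a MIP optimum with no checkable artefact; this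
route makes [[90,8,10]] a kernel-checked theorem.

RANKED CRUXES. #0 Target (target) — the printed row — QC(x⁹+y+y², 1+x²+x⁷) on ℤ₁₅ × ℤ₃ has
parameters [[90, 8, 10]] (n = 90 data qubits, k = 8, distance EXACTLY 10). (why it might fail: only
if the printed MIP distance or dimension is wrong — four independent cell kernels (bruteforce,
CNF/LRAT, Brouwer–Zimmermann, matrix-method) agree on 8 and 10.) [BravyiEtAl2024, arXiv:2308.07915]
#2 NoZLogicalBelowTen (crux) — LOWER BOUND — every v with H^X v = 0 and v ∉ rowspace(H^Z) (a Z-type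
logical operator of BB.bb90) has Hamming weight ≥ 10; equivalently no Z-logical of weight ≤ 9
exists. Discharged by a kernel-replayed enumeration / UNSAT certificate (certA bz a5d2f23cbb488a6a,
certB LRAT 1ac6a0cc1f6d3ffd, or search-7's information-set certificate), via `CertCheck` soundness +
`BB.Code.dZ_eq_of_flat`. PATH OF RECORD (director-qec 2026-08-26 21:14:06Z, P2 branch 3): kernel-A
Brouwer–Zimmermann with automorphisms + parity (d = 10 even ⇒ W = 8) through the code-generic
`Census/CertCheckBZ.lean` (10.BZC) right after [[144,12,12]]; kernel-B LRAT trees are NOT filed for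
n = 90 (Σ > 8 M hints at ≤ 200 000 B/module); k = 8 is already KERNEL-std (type-02 p467713).
[difficulty: M] (why it might fail: false iff a Z-logical of weight ≤ 9 exists (printed d by MIP,
uncertified); residual risk after two signed certificates = an index-convention slip between the
checker's flat literal and `BB.bb90` (x = S_ℓ ⊗ I_m vs I ⊗ S).) [BravyiEtAl2024, arXiv:2308.07915,
Vardy1997, KapshikarKundu2023]
#3 WeightTenZLogical (crux) — UPPER WITNESS — there is an explicit v with H^X v = 0, v ∉
rowspace(H^Z) and |v| = 10 (a weight-10 Z-type logical operator); the certificates list one (certA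
`upper.Z.word`), non-membership in rowspace(H^Z) is a rank / syndrome check decidable on the literal
matrices. [difficulty: S] (why it might fail: false iff d ≥ 11 (every weight-10 kernel word of H^X
is a Z-stabiliser); the listed witness could be mis-transcribed or secretly in rowspace(H^Z) — the
non-membership proof is the delicate part in Lean.) [BravyiEtAl2024, arXiv:2308.07915]
#9 EightLogicalQubits90 (support) — DIMENSION — k(BB.bb90) = 90 − rk H^X − rk H^Z = 8 (rk H^X = rk
H^Z = 41 over 𝔽₂), by a rank certificate (type-02's Census/RankCert.lean p462257) transported with
`BB.Code.cssFlat_k`; equivalently k = 2·dim(ker A ∩ ker B) (Lemma 1). [difficulty: provable-now]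
[BravyiEtAl2024, arXiv:2308.07915, CalderbankShor1996]

TWO-LAYER PLAN. Foreseen split of NoZLogicalBelowTen only if the monolithic kernel replay is too
heavy: NoZLogicalBelowTen ⇐ (checker soundness: `checkDistCert cert = true → ∀ v, …` on the flat
code, type-10 CertCheck) → (the data fact `checkDistCert cert = true`, by `decide +kernel` in ≤
400-line chunk files, search-7 emitter; or the information-set variant, one light file per side) →
NoZLogicalBelowTen via `BB.Code.dZ_eq_of_flat`; k ≤ 3 children, depth 1. Nothing filed now.

KILL CRITERIA. A kernel-checked Z-logical (or X-logical, d^X = d^Z) of weight ≤ 9 refutes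
NoZLogicalBelowTen and the CLAIM itself (route closes refuted:NoZLogicalBelowTen and the census row
becomes a DISCREPANCY finding against Nature 627 Table 1); a proof that rk H^X ≠ 41 refutes
EightLogicalQubits90 likewise. A proof of `BB90_8_10_claim` landed by any other cell file (e.g.
search-7's CertNative/Kernel files + Distance.lean discharging the claim directly) moots the route —
it is then closed superseded with the discharging theorem named.

NOT DECOMPOSED YET. The checker-soundness / data-fact split of the lower bound (Two-layer plan), the
X-side mirror statements (unnecessary: d^X = d^Z is a tree theorem), and the per-chunk leaf theorems
of the kernel replay — all are prover-side packaging below item level (attached with --supports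
NoZLogicalBelowTen), never items.

CHEAPEST FALSIFIER. Run any distance tool on the H^X = [A|B], H^Z = [Bᵀ|Aᵀ] matrices of BB.bb90 and
look for a logical of weight ≤ 9. Done inside the cell before filing: Σ_{w≤9} C(90,w) supports per
side is out of bruteforce range; certA used Brouwer–Zimmermann with the translation automorphism
group (orbit lemma p461461), certB a CNF whose UNSAT proof is LRAT-checked; ref-1
replayed/re-derived both certificates and ROW-SIGNED (2026-08-26T18:40:03Z, assumes=none).

NUMBERS. n = 90 = 2·15·3; k = 8; d = d^X = d^Z = 10 (Nature 627 Table 1); rk H^X = rk H^Z = 41;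
kernel path of record for d = 10 = the kernel-B leaf chain (search-2 cubes → search-10 leaf files →
type-11 LRATBridge; mitm is infeasible at d = 10, search-9) or the bz-in-Lean checker 10.L5 (type-10
+ type-07 BrouwerZimmermannBound + search-7 CertInfoSet).

DEFINITION REQUESTS. None: `BB.Code`, `BB.bb90`, `CSSCode.dZ/dX/k/rowSpZ`, `hammingNorm`,
`HasParams`, the flat bridge `BB.Code.cssFlat` (+ `dZ_eq_of_flat`, `cssFlat_k`) and the checker
`Census/CertCheck.lean` are all in the tree. Cite fact wanted: none (BravyiEtAl2024 is in
references.bib; the claim decl carries the locators).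

Novelty: Searches (2026-08-26): lit search "bivariate bicycle code distance" (6 local docs: arXiv:2308.07915,
2502.20189, 2510.06495, 2411.03302, 2605.14173, 2503.22071; 13 remote merged, OpenAlex/S2
rate-limited); lit galaxy search "bivariate bicycle|[[90,8,10]]|BB code distance" --star all (panama
0, pdf 5 decoder papers, crabby 0); cell literature seats lit-3 (LIT-3-CONSTRUCTIONS.md v1.1: "how d
was established in print" = MILP for all five BB rows, Nature ED Table 1 caption p0011) and lit-1
(LIT-1-REGISTER.md: families with proved d vs exhaustive/LP vs upper-bound-only).
Nearest prior art found: BravyiEtAl2024 = arXiv:2308.07915 (Nature 627, 778) Table 1 / ED Table 1 —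
the parameters by mixed-integer programming (their ref. 68), no certificate; arXiv:2502.20189 Table
I reprints the row; QDistRnd-style randomized upper bounds (Pryadko et al.) for related two-block
codes (lit-3 A2/A3).
Delta: an INDEPENDENT certificate that QC(x⁹+y+y², 1+x²+x⁷) on ℤ₁₅ × ℤ₃ has distance exactly 10 and
k = 8 on the typed literature object BB.bb90, checked by the Lean kernel with standard axioms only
(KERNEL-std: decide / proof terms, no compiled-reflection axiom), from two independent certificate
kernels (certA a5d2f23cbb488a6a (bz) ∧ certB 1ac6a0cc1f6d3ffd (enc-v1 LRAT)) with referee signatures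
— print has solver (MIP) output only. PRIOR ART (director 20:47:46Z, FINDINGS PA-1): Lean-QEC
(Ehatamm–Lee–Wu–Tao, arXiv:2605.16523, May 2026; repo VerifiedQC/Lean-QEC) proves BB72 d ≥ 6 by
bv_decide on LRAT f  [refs: 2308.07915, 2502.20189, 2605.16523, BravyiEtAl2024]

Barriers (technique_class: certified-computation, enumeration, unsat-cert): - technique_class: certified-computation, enumeration, unsat-cert
- Literature.Barriers.Ventures: no catalogued barrier directory exists for Ventures (ls
lean/Literature/Barriers/ has none); the technique-class barrier is NP-hardness of minimum distance
—
`Literature.InformationTheory.QuantumCodes.MinimumDistanceHardness.Vardy1997_minimumDistance_isNPComplete`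
and `KapshikarKundu2023_quantumMinimumDistance_isNPHard` (tree, named facts): they bound the
asymptotic cost of a uniform algorithm, not a fixed instance — n = 90, w ≤ 9 is a fixed finite
instance, enumerated with symmetry reduction / UNSAT-certified and kernel-replayed; the route does
not claim a method that scales.
- Negatives index: empty for Ventures/QEC at filing (ledger negatives --problem Ventures consulted
by the cell's refuter seats; no refuted statement about BB codes).

History (route lifecycle, newest last):
- 2026-08-27T01:14:40Z · CLOSED proved — proved:Summit.Ventures.QEC.Census.BB90.BB90_8_10_claim_holds (operator:999:3137891)

sub-problem: QEC · status: closed(proved) · opened operator:999:1121542 2026-08-26T22:09:01Z · rev 0 · ledger route-Ventures-BB90DistanceCertificate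
GENERATED by the gate from the ledger (D-0016/17). Provers cite these decls: `theorem foo : Summit.Ventures.QEC.Theses.BB90DistanceCertificate.<Decl> := …` in Summits/Ventures/QEC/Theorems/<Name>.lean.
-/

namespace Summit.Ventures.QEC.Theses.BB90DistanceCertificate

open scoped BigOperators Topology Manifold Classical MeasureTheory ProbabilityTheory Matrix InnerProductSpace ComplexConjugate ContinuousMap
open Filter Set Function TopologicalSpace MeasureTheory

-- H21.Audit: Ventures rung route — no summit Statement decl; the expected conclusion is the closer leaf tagged below
attribute [summit_statement] _root_.Summit.Ventures.QEC.BB.BB90_8_10_claim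

/-- item stmt-Ventures-19780 · target · rank 0 · closed · proved by Summit.Ventures.QEC.Census.BB90.target90_proof (prover) · by operator
why it might fail: only if the printed MIP distance or dimension is wrong — four independent cell kernels (bruteforce, CNF/LRAT, Brouwer–Zimmermann, matrix-method) agree on 8 and 10.
sources: BravyiEtAl2024, arXiv:2308.07915
[target] the printed row — QC(x⁹+y+y², 1+x²+x⁷) on ℤ₁₅ × ℤ₃ has parameters [[90, 8, 10]] (n = 90
data qubits, k = 8, distance EXACTLY 10). -/
@[route_item "route-Ventures-BB90DistanceCertificate"]
def Target : Prop :=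
  Summit.Ventures.QEC.BB.BB90_8_10_claim

-- `Target` holds: proved by `Summit.Ventures.QEC.Census.BB90.target90_proof` (its module imports this route file, so no `_holds` link can be stated here).

/-- item stmt-Ventures-19781 · crux · rank 2 · closed · proved by Summit.Ventures.QEC.Census.BB90.noZLogicalBelowTen_proof (prover) · by operator
why it might fail: false iff a Z-logical of weight ≤ 9 exists (printed d by MIP, uncertified); residual risk after two signed certificates = an index-convention slip between the checker's flat literal and `BB.bb90` (x = S_ℓ ⊗ I_m vs I ⊗ S).
sources: BravyiEtAl2024, arXiv:2308.07915, Vardy1997, KapshikarKundu2023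
[crux] LOWER BOUND — every v with H^X v = 0 and v ∉ rowspace(H^Z) (a Z-type logical operator of
BB.bb90) has Hamming weight ≥ 10; equivalently no Z-logical of weight ≤ 9 exists. Discharged by a
kernel-replayed enumeration / UNSAT certificate (certA bz a5d2f23cbb488a6a, certB LRAT
1ac6a0cc1f6d3ffd, or search-7's information-set certificate), via `CertCheck` soundness +
`BB.Code.dZ_eq_of_flat`. PATH OF RECORD (director-qec 2026-08-26 21:14:06Z, P2 branch 3): kernel-A
Brouwer–Zimmermann with automorphisms + parity (d = 10 even ⇒ W = 8) through the code-generic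
`Census/CertCheckBZ.lean` (10.BZC) right after [[144,12,12]]; kernel-B LRAT trees are NOT filed for
n = 90 (Σ > 8 M hints at ≤ 200 000 B/module); k = 8 is already KERNEL-std (type-02 p467713).
[difficulty: M] -/
@[route_item "route-Ventures-BB90DistanceCertificate"]
def NoZLogicalBelowTen : Prop :=
  ∀ v : Literature.InformationTheory.QuantumCodes.BB.Mono 15 3 ⊕ Literature.InformationTheory.QuantumCodes.BB.Mono 15 3 → ZMod 2, Matrix.mulVec (Literature.InformationTheory.QuantumCodes.BB.bb90).css.HX v = 0 → v ∉ (Literature.InformationTheory.QuantumCodes.BB.bb90).css.rowSpZ → 10 ≤ hammingNorm v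

-- `NoZLogicalBelowTen` holds: proved by `Summit.Ventures.QEC.Census.BB90.noZLogicalBelowTen_proof` (its module imports this route file, so no `_holds` link can be stated here).

/-- item stmt-Ventures-19782 · crux · rank 3 · closed · proved by Summit.Ventures.QEC.Census.BB90.weightTenZLogical_proof (prover) · by operator
why it might fail: false iff d ≥ 11 (every weight-10 kernel word of H^X is a Z-stabiliser); the listed witness could be mis-transcribed or secretly in rowspace(H^Z) — the non-membership proof is the delicate part in Lean.
sources: BravyiEtAl2024, arXiv:2308.07915
[crux] UPPER WITNESS — there is an explicit v with H^X v = 0, v ∉ rowspace(H^Z) and |v| = 10 (a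
weight-10 Z-type logical operator); the certificates list one (certA `upper.Z.word`), non-membership
in rowspace(H^Z) is a rank / syndrome check decidable on the literal matrices. [difficulty: S] -/
@[route_item "route-Ventures-BB90DistanceCertificate"]
def WeightTenZLogical : Prop :=
  ∃ v : Literature.InformationTheory.QuantumCodes.BB.Mono 15 3 ⊕ Literature.InformationTheory.QuantumCodes.BB.Mono 15 3 → ZMod 2, Matrix.mulVec (Literature.InformationTheory.QuantumCodes.BB.bb90).css.HX v = 0 ∧ v ∉ (Literature.InformationTheory.QuantumCodes.BB.bb90).css.rowSpZ ∧ hammingNorm v = 10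

-- `WeightTenZLogical` holds: proved by `Summit.Ventures.QEC.Census.BB90.weightTenZLogical_proof` (its module imports this route file, so no `_holds` link can be stated here).

/-- item stmt-Ventures-19783 · support · rank 9 · closed · proved by Summit.Ventures.QEC.Theorems.EightLogicalQubits90_proof (prover) · by operator
sources: BravyiEtAl2024, arXiv:2308.07915, CalderbankShor1996
[support] DIMENSION — k(BB.bb90) = 90 − rk H^X − rk H^Z = 8 (rk H^X = rk H^Z = 41 over 𝔽₂), by a
rank certificate (type-02's Census/RankCert.lean p462257) transported with `BB.Code.cssFlat_k`;
equivalently k = 2·dim(ker A ∩ ker B) (Lemma 1). [difficulty: provable-now] -/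
@[route_item "route-Ventures-BB90DistanceCertificate"]
def EightLogicalQubits90 : Prop :=
  (Literature.InformationTheory.QuantumCodes.BB.bb90).k = 8

-- `EightLogicalQubits90` holds: proved by `Summit.Ventures.QEC.Theorems.EightLogicalQubits90_proof` (its module imports this route file, so no `_holds` link can be stated here).

/-- item stmt-Ventures-19784 · assembly · rank 1 · closed · proved by Summit.Ventures.QEC.Theorems.bb90DistanceCertificate_assembly_proof (prover) · by operator
sources: BravyiEtAl2024
[assembly] NoZLogicalBelowTen → WeightTenZLogical → EightLogicalQubits90 → the [[90,8,10]] claim. -/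
@[route_item "route-Ventures-BB90DistanceCertificate"]
def Assembly : Prop :=
  NoZLogicalBelowTen → WeightTenZLogical → EightLogicalQubits90 → Summit.Ventures.QEC.BB.BB90_8_10_claim

-- `Assembly` holds: proved by `Summit.Ventures.QEC.Theorems.bb90DistanceCertificate_assembly_proof` (its module imports this route file, so no `_holds` link can be stated here).

/-! D-0027 §2.1 — DECIDING THEOREM (planner-authored via `route open/edit --closes-file`; by operator:999:1121542 2026-08-26T22:09:01Z) — ARCHIVED: route closed (proved) 2026-08-27T01:14:40Z; kept so importers keep building:
its hypotheses are this route's items and its conclusion the registered leaf `Summit.Ventures.QEC.BB.BB90_8_10_claim` (rung Q2, D-0061) (glue_lint), and it elaborates with this file. -/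

/-- **Deciding theorem of route BB90DistanceCertificate** (Ventures/QEC rung Q2; D-0027 §2.1, D-0059/D-0061/D-0092:
closes_target = the registered CLAIM leaf `Summit.Ventures.QEC.BB.BB90_8_10_claim`, never a summit Statement).
Lower bound + explicit weight-d witness ⇒ d^Z(BB.bb90) = d (`CSSCode.dZ_eq_of_witness`); n by counting
(`numQubits_claims.2.1`); k (support item); then `hasParams_of_dZ` (Lemma 1 of Bravyi et al.: `d = d^Z`, tree theorem
`BB.Code.d_eq_dZ`). Routed THROUGH `Assembly` and `Target` so both decls are in the cone of `closes`; every binder load-bearing;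
fully qualified names, no `open`. -/
@[closes "route-Ventures-BB90DistanceCertificate"] theorem closes (hL : NoZLogicalBelowTen) (hU : WeightTenZLogical) (hK : EightLogicalQubits90) :
    Summit.Ventures.QEC.BB.BB90_8_10_claim := by
  have hA : Assembly := fun hL' hU' hK' => by
    obtain ⟨v, hv, hv', hwt⟩ := hU'
    exact Summit.Ventures.QEC.BB.hasParams_of_dZ Summit.Ventures.QEC.BB.numQubits_claims.2.1 hK'
      ((Literature.InformationTheory.QuantumCodes.BB.bb90).css.dZ_eq_of_witness hv hv' hwt hL')
  have hT : Target := hA hL hU hK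
  exact hT

end Summit.Ventures.QEC.Theses.BB90DistanceCertificate
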